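import Summits.ResolutionOfSingularities.ResolutionOfSingularities.Theorems.EquisingularLiftEquisingularLiftOfSigmaMaxCP2008
import Summits.ResolutionOfSingularities.ResolutionOfSingularities.Theorems.EquisingularLiftEquisingularLiftBlowupModelProjectiveResolution
import HarnessLib

/-!
# Crux `EquisingularLift` (stmt-ResolutionOfSingularities-15660), line `Sketch` (skeleton v10c `f3e6993bf39ec5c9`):
# the crux and the line's assembly with the open residual spelled as PROJECTIVE RESOLUTION

[OURS · leafhand-res-equisingularlift-6 g1, 2026-08-31] AI-produced, weaker than expert review; NOT a statement of any
manuscript; nothing here proves resolution of singularities in positive characteristic, and NO registered stub is closed.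

With the dictionary `blowupModel_iff_projectiveResolution` (file `…BlowupModelProjectiveResolution`, p816118: for an integral
closed `H ⊆ ℙⁿ_k`, «a non-zero ideal sheaf all of whose blow-ups are regular» ⟺ «a resolution of singularities with source
projective over `k`») the line's statements can be read in the summit's own vocabulary (`IsResolution`, `IsProjectiveOver`):

* `equisingularLift_of_projectiveResolutions_ge_three` — **`EquisingularLift` ⟸ every integral closed `H ⊆ ℙⁿ_k̄`, `n ≥ 3`,
  char `p`, with locally principal ideal has a resolution of singularities with projective source** (unconditional
  implication: the dictionary + the linear-centre lift `equisingularLift_of_blowupModels`);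
* `EquisingularLift_of_sigmaMaxElimination_CP2008_of_projectiveResolutions_ge_five` — the line's conditional assembly
  (`EquisingularLift_of_sigmaMaxElimination_CP2008_of_blowupModels_ge_five`, p798346) with its open residual `h5` restated:
  **projective resolution of integral hypersurfaces of `ℙⁿ_k̄` for `n ≥ 5`** (= projective resolution of singularities in
  dimension `≥ 4` over algebraically closed fields; barrier `DimensionFourFrontier`), next to CJS Thm. 6.28
  (`CossartJannsenSaito2020_sigmaMaxElimination`) and Cossart–Piltant 2008 Thm. 2.1 (`CP2008.ResolutionQuasiProjectiveThreefolds`);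
* `EquisingularLift_of_sigmaMaxElimination_CP2019General_of_projectiveResolutions_ge_five` — the same with Cossart–Piltant
  2019 Thm. 1.1 (`CossartPiltant2019General`, the registered stub `stub_CP2019General`).

Honest label: re-lettering of CONDITIONAL results; `--supports stmt-ResolutionOfSingularities-15660 --as helper`, DEF-FREE,
standard axioms, zero named hypotheses beyond the displayed binders.

References: [Liu2002, Thm. 8.1.24]; [Hartshorne1977, II.7.17]; [CossartJannsenSaito2020, Thm. 6.28, Cor. 6.18];
[CossartPiltant2008, Thm. 2.1]; [CossartPiltant2019, Thm. 1.1].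
-/

set_option linter.dupNamespace false -- mandated namespace `Summit.<Summit>.<Problem>` of this single-conjunct summit

noncomputable section

open CategoryTheory AlgebraicGeometry
open Literature.AlgebraicGeometry.Resolution Literature.AlgebraicGeometry.Motives Literature.AlgebraicGeometry.CossartPiltant200819

namespace Summit.ResolutionOfSingularities.ResolutionOfSingularities.Cruxes.EquisingularLift.StrataSplit

/-- **`EquisingularLift` from projective resolutions of integral hypersurfaces of `ℙⁿ_k̄`, `n ≥ 3`** (unconditional
implication): a resolution with projective source is a regular blow-up model (`blowupModel_of_projectiveResolution`, Liu 2002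
Thm. 8.1.24 discharged), and regular blow-up models for `n ≥ 3` give the crux by the linear-centre lift
(`equisingularLift_of_blowupModels`). [cite: Liu2002, Thm. 8.1.24] [cite: Hartshorne1977, II.7.17] -/
theorem equisingularLift_of_projectiveResolutions_ge_three
    (hres : ∀ p : ℕ, p.Prime → ∀ (k : Type) [Field k] [CharP k p] [IsAlgClosed k] (n : ℕ) (H : AlgebraicGeometry.Scheme.{0}) (ι : H ⟶ (Literature.AlgebraicGeometry.Motives.projectiveSpace n k).left), AlgebraicGeometry.IsClosedImmersion ι → AlgebraicGeometry.IsIntegral H → (∀ y : (Literature.AlgebraicGeometry.Motives.projectiveSpace n k).left, ∃ U : (Literature.AlgebraicGeometry.Motives.projectiveSpace n k).left.affineOpens, y ∈ (U : (Literature.AlgebraicGeometry.Motives.projectiveSpace n k).left.Opens) ∧ (ι.ker.ideal U).IsPrincipal) → 3 ≤ n → ∃ (Z : AlgebraicGeometry.Scheme.{0}) (π : Z ⟶ H), Literature.AlgebraicGeometry.Resolution.IsResolution π ∧ Literature.AlgebraicGeometry.Motives.IsProjectiveOver (CategoryTheory.Over.mk (π ≫ ι ≫ (Literature.AlgebraicGeometry.Motives.projectiveSpace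 n k).hom))) :
    Summit.ResolutionOfSingularities.ResolutionOfSingularities.Theses.EquisingularLift.EquisingularLift := by
  refine equisingularLift_of_blowupModels ?_
  intro p hp k _ _ _ n H ι hι hH hloc hn
  haveI := hι
  haveI := hH
  exact blowupModel_of_projectiveResolution ι (hres p hp k n H ι hι hH hloc hn)

/-- **The line's assembly with the open residual as PROJECTIVE RESOLUTION** (CONDITIONAL): `EquisingularLift` from CJS
Thm. 6.28 (`Σ^max`-eliminations in dimension `≤ 2`), Cossart–Piltant 2008 Thm. 2.1 (quasi-projective threefolds) and
«every integral closed `H ⊆ ℙⁿ_k̄`, `n ≥ 5`, char `p`, with locally principal ideal has a resolution of singularities with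
projective source» (the dictionary `blowupModels_ge_five_iff_projectiveResolutions_ge_five` applied to the residual `h5` of
`EquisingularLift_of_sigmaMaxElimination_CP2008_of_blowupModels_ge_five`). [cite: CossartJannsenSaito2020, Thm. 6.28, Cor. 6.18]
[cite: CossartPiltant2008, Thm. 2.1] [cite: Liu2002, Thm. 8.1.24] -/
theorem EquisingularLift_of_sigmaMaxElimination_CP2008_of_projectiveResolutions_ge_five
    (hσ : CossartJannsenSaito2020_sigmaMaxElimination.{0}) (h2008 : CP2008.ResolutionQuasiProjectiveThreefolds.{0})
    (h5 : ∀ p : ℕ, p.Prime → ∀ (k : Type) [Field k] [CharP k p] [IsAlgClosed k] (n : ℕ) (H : AlgebraicGeometry.Scheme.{0}) (ι : H ⟶ (Literature.AlgebraicGeometry.Motives.projectiveSpace n k).left), AlgebraicGeometry.IsClosedImmersion ι → AlgebraicGeometry.IsIntegral H → (∀ y : (Literature.AlgebraicGeometry.Motives.projectiveSpace n k).left, ∃ U : (Literature.AlgebraicGeometry.Motives.projectiveSpace n k).left.affineOpens, y ∈ (U : (Literature.AlgebraicGeometry.Motives.projectiveSpace n k).left.Opens) ∧ (ι.ker.ideal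 U).IsPrincipal) → 5 ≤ n → ∃ (Z : AlgebraicGeometry.Scheme.{0}) (π : Z ⟶ H), Literature.AlgebraicGeometry.Resolution.IsResolution π ∧ Literature.AlgebraicGeometry.Motives.IsProjectiveOver (CategoryTheory.Over.mk (π ≫ ι ≫ (Literature.AlgebraicGeometry.Motives.projectiveSpace n k).hom))) :
    Summit.ResolutionOfSingularities.ResolutionOfSingularities.Theses.EquisingularLift.EquisingularLift :=
  EquisingularLift_of_sigmaMaxElimination_CP2008_of_blowupModels_ge_five hσ h2008
    (blowupModels_ge_five_iff_projectiveResolutions_ge_five.mpr h5)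

/-- **The same with Cossart–Piltant 2019 Thm. 1.1 (i)(ii)** (`CossartPiltant2019General`, the registered stub
`stub_CP2019General`) in place of the 2008 theorem (CONDITIONAL). [cite: CossartJannsenSaito2020, Thm. 6.28, Cor. 6.18]
[cite: CossartPiltant2019, Thm. 1.1] [cite: Liu2002, Thm. 8.1.24] -/
theorem EquisingularLift_of_sigmaMaxElimination_CP2019General_of_projectiveResolutions_ge_five
    (hσ : CossartJannsenSaito2020_sigmaMaxElimination.{0}) (hCP : CossartPiltant2019General.{0})
    (h5 : ∀ p : ℕ, p.Prime → ∀ (k : Type) [Field k] [CharP k p] [IsAlgClosed k] (n : ℕ) (H : AlgebraicGeometry.Scheme.{0}) (ι : H ⟶ (Literature.AlgebraicGeometry.Motives.projectiveSpace n k).left), AlgebraicGeometry.IsClosedImmersion ι → AlgebraicGeometry.IsIntegral H → (∀ y : (Literature.AlgebraicGeometry.Motives.projectiveSpace n k).left, ∃ U : (Literature.AlgebraicGeometry.Motives.projectiveSpace n k).left.affineOpens, y ∈ (U : (Literature.AlgebraicGeometry.Motives.projectiveSpace n k).left.Opens) ∧ (ι.ker.ideal U).IsPrincipal) → 5 ≤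 n → ∃ (Z : AlgebraicGeometry.Scheme.{0}) (π : Z ⟶ H), Literature.AlgebraicGeometry.Resolution.IsResolution π ∧ Literature.AlgebraicGeometry.Motives.IsProjectiveOver (CategoryTheory.Over.mk (π ≫ ι ≫ (Literature.AlgebraicGeometry.Motives.projectiveSpace n k).hom))) :
    Summit.ResolutionOfSingularities.ResolutionOfSingularities.Theses.EquisingularLift.EquisingularLift :=
  EquisingularLift_of_sigmaMaxElimination_CP2019General_of_blowupModels_ge_five hσ hCP
    (blowupModels_ge_five_iff_projectiveResolutions_ge_five.mpr h5)

end Summit.ResolutionOfSingularities.ResolutionOfSingularities.Cruxes.EquisingularLift.StrataSplit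

end
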